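import Literature.NumberTheory.Automorphic.UnramifiedIntegralConjugacy
import Literature.LinearAlgebra.Matrix.IntegralConjugacyOfIdempotents
import Literature.LinearAlgebra.Matrix.IntegralUnitaryConjugacyOfIdempotents
import HarnessLib

/-!
# Integral conjugacy in `U(J)(F_v)` at almost every place for a SEMISIMPLE element with two rational eigenvalues: `GL`-conjugate points of the
# hyperspecial level are `U(J)(𝒪_v)`-conjugate (Kottwitz 1986, Prop. 7.1 ∕ §7.3; Rogawski 1990, §3.3 p. 21, §3.8 p. 27)

Topic `NumberTheory/Automorphic`; namespace `Literature.NumberTheory.Automorphic.UnitaryGroup`; THEOREMS ONLY (no definition, no instance, no named fact,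
no `sorry`).  The SEMISIMPLE twin of ★ `UnramifiedIntegralConjugacy` (`eventually_forall_integralConj`, REGULAR `γ`).  At a singular semisimple class «same
characteristic polynomial» no longer detects conjugacy (a scalar times a unipotent has the characteristic polynomial of the scalar), so the premise is
`GL_N(E ⊗ F_v)`-CONJUGACY of `g′ ∈ U(J)(𝒪_v)` to `γ ⊗ 1` (★ `Rogawski1990.Corresponds` unfolded), and the element comes with its quadratic relation
`(γ − a)(γ − b) = 0`, `a ≠ b ∈ E`, `a c(a) = b c(b) = 1` — the shape of every singular non-central semisimple element of `U(3)` (eigenvalues `{a, a, b}`, ★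
`Rogawski1990.exists_singular_frame`).  Integral inputs: at a SPLIT place ★ `LinearAlgebra.Matrix.exists_units_conj_eq_of_units_conj_map_eq`
(`IntegralConjugacyOfIdempotents`: over a local ring, `GL`-conjugate matrices killed by `(X − a)(X − b)` with `a − b` a unit are integrally conjugate); at a
NON-SPLIT unramified place its unitary upgrade ★ `LinearAlgebra.Matrix.exists_integral_unitary_conj_of_mul_sub_eq_zero` (`IntegralUnitaryConjugacyOfIdempotents`).

* §1 **`integralConj_of_split_of_mul_sub_eq_zero`** — split `w ∣ v`, along ★ `localSplitEquiv`;
* §2 **`integralConj_unitaryGroupOfForm_of_mul_sub_eq_zero`** (one-place model `U(σ_w, J_w)(E_w)`), **`integralConj_of_nonsplit_of_mul_sub_eq_zero`** —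
  non-split unramified `w ∣ v`, along ★ `localNonsplitEquiv`;
* §3 **`eventually_forall_integralConj_of_mul_sub_eq_zero`** — for all but finitely many `v`, every `g′ ∈ U(J)(𝒪_v)` which is `GL_N(E ⊗ F_v)`-conjugate to
  `γ ⊗ 1` is conjugate to it by an element of `U(J)(𝒪_v)`.  CM dress (`cmDatum`, semisimple `γ ∈ U(H)(L⁺)`): `Rogawski1990/MatchingAdeleGKConjSemisimple`.

## References
* [Kottwitz1986] R. E. Kottwitz, *Stable trace formula: elliptic singular terms*, Math. Ann. 275 (1986), Prop. 7.1, §7.3.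
* [Rogawski1990] J. D. Rogawski, *Automorphic Representations of Unitary Groups in Three Variables*, Ann. of Math. Stud. 123 (1990), §3.3 p. 21, §3.8 p. 27.
-/

set_option autoImplicit false

noncomputable section

open NumberField IsDedekindDomain Filter Polynomial
open scoped Matrix Pointwise

namespace Literature.NumberTheory.Automorphic.UnitaryGroup

/-! ## §1 The split place -/

section Split

variable {F E : Type} [Field F] [NumberField F] [Field E] [NumberField E] [Algebra F E]
  (c : E ≃ₐ[F] E) (N : ℕ) (J : Matrix (Fin N) (Fin N) E)

variable [Algebra.IsQuadraticExtension F E] {v : HeightOneSpectrum (𝓞 F)}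

/-- `(M − a·1).map f = M.map f − f(a)·1` for a ring map `f`. [folklore] -/
private theorem map_sub_smul_one {R S : Type*} [CommRing R] [CommRing S] (f : R →+* S) (M : Matrix (Fin N) (Fin N) R) (a : R) :
    (M - a • (1 : Matrix (Fin N) (Fin N) R)).map f = M.map f - f a • (1 : Matrix (Fin N) (Fin N) S) := by
  ext i j
  by_cases h : i = j
  · subst h; simp
  · simp [h]

/-- A polynomial relation `(M − a)(M − b) = 0` passes along an injective change of rings (read backwards). [cite: Kottwitz1986, §7.3] -/
private theorem mul_sub_eq_zero_of_map {R S : Type*} [CommRing R] [CommRing S] (f : R →+* S) (hf : Function.Injective f)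
    {M : Matrix (Fin N) (Fin N) R} {a b : R}
    (h : (M.map f - f a • (1 : Matrix (Fin N) (Fin N) S)) * (M.map f - f b • (1 : Matrix (Fin N) (Fin N) S)) = 0) :
    (M - a • (1 : Matrix (Fin N) (Fin N) R)) * (M - b • (1 : Matrix (Fin N) (Fin N) R)) = 0 := by
  have hinj : Function.Injective (fun X : Matrix (Fin N) (Fin N) R => X.map f) := fun X Y hXY =>
    Matrix.ext fun i j => hf (by simpa using congrFun (congrFun hXY i) j)
  apply hinj
  change ((M - a • (1 : Matrix (Fin N) (Fin N) R)) * (M - b • (1 : Matrix (Fin N) (Fin N) R))).map f = (0 : Matrix (Fin N) (Fin N) R).map f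
  rw [Matrix.map_mul, map_sub_smul_one, map_sub_smul_one, Matrix.map_zero f (map_zero f)]
  exact h

/-- A polynomial relation `(M − a)(M − b) = 0` passes along a change of rings (read forwards). [cite: Kottwitz1986, §7.3] -/
private theorem map_mul_sub_eq_zero {R S : Type*} [CommRing R] [CommRing S] (f : R →+* S) {M : Matrix (Fin N) (Fin N) R} {a b : R}
    (h : (M - a • (1 : Matrix (Fin N) (Fin N) R)) * (M - b • (1 : Matrix (Fin N) (Fin N) R)) = 0) :
    (M.map f - f a • (1 : Matrix (Fin N) (Fin N) S)) * (M.map f - f b • (1 : Matrix (Fin N) (Fin N) S)) = 0 := by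
  have h1 := congrArg (fun X : Matrix (Fin N) (Fin N) R => X.map f) h
  simp only [Matrix.map_mul, map_sub_smul_one, Matrix.map_zero f (map_zero f)] at h1
  exact h1

/-- Conjugation preserves `(M − a)(M − b) = 0`. [cite: Kottwitz1986, §7.3] -/
private theorem mul_sub_eq_zero_of_units_conj {S : Type*} [CommRing S] {M : Matrix (Fin N) (Fin N) S} {a b : S} (P : GL (Fin N) S)
    (h : (M - a • (1 : Matrix (Fin N) (Fin N) S)) * (M - b • (1 : Matrix (Fin N) (Fin N) S)) = 0) :
    ((P : Matrix (Fin N) (Fin N) S) * M * ((P⁻¹ : GL (Fin N) S) : Matrix (Fin N) (Fin N) S) - a • (1 : Matrix (Fin N) (Fin N) S)) *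
      ((P : Matrix (Fin N) (Fin N) S) * M * ((P⁻¹ : GL (Fin N) S) : Matrix (Fin N) (Fin N) S) - b • (1 : Matrix (Fin N) (Fin N) S)) = 0 := by
  have hconj : ∀ x : S, (P : Matrix (Fin N) (Fin N) S) * M * ((P⁻¹ : GL (Fin N) S) : Matrix (Fin N) (Fin N) S) - x • (1 : Matrix (Fin N) (Fin N) S) =
      (P : Matrix (Fin N) (Fin N) S) * (M - x • 1) * ((P⁻¹ : GL (Fin N) S) : Matrix (Fin N) (Fin N) S) := fun x => by
    rw [Matrix.mul_sub, Matrix.sub_mul, Matrix.mul_smul, Matrix.mul_one, Matrix.smul_mul, Units.mul_inv]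
  rw [hconj, hconj]
  calc (P : Matrix (Fin N) (Fin N) S) * (M - a • 1) * ((P⁻¹ : GL (Fin N) S) : Matrix (Fin N) (Fin N) S) *
        ((P : Matrix (Fin N) (Fin N) S) * (M - b • 1) * ((P⁻¹ : GL (Fin N) S) : Matrix (Fin N) (Fin N) S))
        = (P : Matrix (Fin N) (Fin N) S) * ((M - a • 1) * (M - b • 1)) * ((P⁻¹ : GL (Fin N) S) : Matrix (Fin N) (Fin N) S) := by
          simp only [Matrix.mul_assoc, Units.inv_mul_cancel_left]
    _ = 0 := by rw [h, Matrix.mul_zero, Matrix.zero_mul]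

/-- **Integral conjugacy at a SPLIT place for a semisimple element with two rational eigenvalues.**  `w ∣ v` split (`c • w ≠ w`), `J` `c`-hermitian with
`J_w ∈ GL_N(𝒪_w)`, `g = γ ⊗ 1 ∈ U(J)(F_v)` with `γ_w ∈ GL_N(𝒪_w)`, `(γ − a)(γ − b) = 0`, `a, b` `w`-integral, `a − b` a `w`-unit: every `g′ ∈ U(J)(𝒪_v)` which is
`GL_N(E ⊗ F_v)`-conjugate to `g` is `U(J)(𝒪_v)`-conjugate to it (★ `exists_units_conj_eq_of_units_conj_map_eq` over `𝒪_w` along ★ `localSplitEquiv`).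
[cite: Kottwitz1986, Prop. 7.1; §7.3] [cite: Rogawski1990, §3.3 p. 21; §3.8 p. 27] -/
theorem integralConj_of_split_of_mul_sub_eq_zero (hc : c ≠ 1) (hJh : (J.map c)ᵀ = J) (w : PlacesOver E v) (hw : c • w.1 ≠ w.1)
    (hJw : IsUnit (placeForm J w.1)) (hJi : hJw.unit ∈ glInt N (w.1.adicCompletion E)) (γ : GL (Fin N) E) {a b : E}
    (hγab : ((γ : Matrix (Fin N) (Fin N) E) - a • 1) * ((γ : Matrix (Fin N) (Fin N) E) - b • 1) = 0)
    (aw bw : w.1.adicCompletionIntegers E) (haw : (aw : w.1.adicCompletion E) = algebraMap E (w.1.adicCompletion E) a)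
    (hbw : (bw : w.1.adicCompletion E) = algebraMap E (w.1.adicCompletion E) b) (habw : IsUnit (aw - bw))
    (g : «local» E c N J v) (hg : (g : GL (Fin N) (LocalRing E v)) = toLocalGL E v γ)
    (hγw : Matrix.GeneralLinearGroup.map (algebraMap E (w.1.adicCompletion E)) γ ∈ glInt N (w.1.adicCompletion E))
    (g' : «local» E c N J v) (hg' : g' ∈ localIntegralLevel c N J v)
    (hconj : IsConj (g' : GL (Fin N) (LocalRing E v)) (g : GL (Fin N) (LocalRing E v))) :
    ∃ k ∈ localIntegralLevel c N J v, k * g * k⁻¹ = g' := by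
  -- integral lifts `γ̃`, `g̃′ ∈ GL_N(𝒪_w)` of `γ_w` and `g′_w`
  obtain ⟨γw, hγw'⟩ := (mem_range_map_adicCompletionIntegers_iff_mem_glInt N w.1 _).2 hγw
  have hg'w : localSplitEquiv c J hc hJh w hw hJw g' ∈ glInt N (w.1.adicCompletion E) :=
    (mem_localIntegralLevel_iff_of_ne c N J hc hJh w hw hJw hJi g').1 hg'
  obtain ⟨gw, hgw'⟩ := (mem_range_map_adicCompletionIntegers_iff_mem_glInt N w.1 _).2 hg'w
  have he : localSplitEquiv c J hc hJh w hw hJw g = Matrix.GeneralLinearGroup.map (w.1.adicCompletionIntegers E).subtype γw := by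
    rw [hγw']
    exact localSplitEquiv_eq_map_of_eq_toLocalGL c N J hc hJh w hw hJw γ g hg
  -- the conjugacy of the lifts in `GL_N(E_w)`: push `hconj` along `localSplitEquiv = GL(eval_w)`
  obtain ⟨C, hC⟩ := isConj_iff.1 hconj.symm
  set ev : LocalRing E v →+* w.1.adicCompletion E := Pi.evalRingHom (fun w' : PlacesOver E v => w'.1.adicCompletion E) w with hev
  have hmapev : ∀ u : «local» E c N J v, localSplitEquiv c J hc hJh w hw hJw u =
      Matrix.GeneralLinearGroup.map ev (u : GL (Fin N) (LocalRing E v)) := fun u => Units.ext (coe_localSplitEquiv_apply c J hc hJh w hw hJw u)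
  have hPconj : (Matrix.GeneralLinearGroup.map ev C : Matrix (Fin N) (Fin N) (w.1.adicCompletion E)) *
      (γw : Matrix (Fin N) (Fin N) (w.1.adicCompletionIntegers E)).map (w.1.adicCompletionIntegers E).subtype *
        (((Matrix.GeneralLinearGroup.map ev C)⁻¹ : GL (Fin N) (w.1.adicCompletion E)) : Matrix (Fin N) (Fin N) (w.1.adicCompletion E)) =
      (gw : Matrix (Fin N) (Fin N) (w.1.adicCompletionIntegers E)).map (w.1.adicCompletionIntegers E).subtype := by
    have h1 : Matrix.GeneralLinearGroup.map ev C * localSplitEquiv c J hc hJh w hw hJw g * (Matrix.GeneralLinearGroup.map ev C)⁻¹ =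
        localSplitEquiv c J hc hJh w hw hJw g' := by
      rw [hmapev, hmapev, ← map_inv, ← map_mul, ← map_mul, hC]
    rw [he, ← hgw'] at h1
    exact congrArg (fun u : GL (Fin N) (w.1.adicCompletion E) => (u : Matrix (Fin N) (Fin N) (w.1.adicCompletion E))) h1
  -- the quadratic relations of the lifts: `γ̃` by injectivity, `g̃′` by conjugation
  have hγwab : ((γw : Matrix (Fin N) (Fin N) (w.1.adicCompletionIntegers E)) - aw • 1) *
      ((γw : Matrix (Fin N) (Fin N) (w.1.adicCompletionIntegers E)) - bw • 1) = 0 := by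
    refine mul_sub_eq_zero_of_map N (w.1.adicCompletionIntegers E).subtype Subtype.val_injective ?_
    have hγmap : (γw : Matrix (Fin N) (Fin N) (w.1.adicCompletionIntegers E)).map (w.1.adicCompletionIntegers E).subtype =
        (γ : Matrix (Fin N) (Fin N) E).map (algebraMap E (w.1.adicCompletion E)) :=
      congrArg (fun u : GL (Fin N) (w.1.adicCompletion E) => (u : Matrix (Fin N) (Fin N) (w.1.adicCompletion E))) hγw'
    rw [hγmap]
    change ((γ : Matrix (Fin N) (Fin N) E).map (algebraMap E (w.1.adicCompletion E)) - (aw : w.1.adicCompletion E) • 1) *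
      ((γ : Matrix (Fin N) (Fin N) E).map (algebraMap E (w.1.adicCompletion E)) - (bw : w.1.adicCompletion E) • 1) = 0
    rw [haw, hbw]
    exact map_mul_sub_eq_zero N (algebraMap E (w.1.adicCompletion E)) hγab
  have hgwab : ((gw : Matrix (Fin N) (Fin N) (w.1.adicCompletionIntegers E)) - aw • 1) *
      ((gw : Matrix (Fin N) (Fin N) (w.1.adicCompletionIntegers E)) - bw • 1) = 0 := by
    refine mul_sub_eq_zero_of_map N (w.1.adicCompletionIntegers E).subtype Subtype.val_injective ?_
    rw [← hPconj]
    exact mul_sub_eq_zero_of_units_conj N _ (map_mul_sub_eq_zero N (w.1.adicCompletionIntegers E).subtype hγwab)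
  -- ★ FILE 1 over the local ring `𝒪_w`: `P γ̃ P⁻¹ = g̃′`
  obtain ⟨P, hP⟩ := Literature.LinearAlgebra.Matrix.exists_units_conj_eq_of_units_conj_map_eq (w.1.adicCompletionIntegers E).subtype
    Subtype.val_injective habw hγwab hgwab (Matrix.GeneralLinearGroup.map ev C) hPconj
  -- transport along `localSplitEquiv`: `k := P ⊗ 1`
  refine integralConj_of_mulEquiv (localSplitEquiv c J hc hJh w hw hJw).toMulEquiv (localIntegralLevel c N J v) (glInt N (w.1.adicCompletion E))
    (fun u => mem_localIntegralLevel_iff_of_ne c N J hc hJh w hw hJw hJi u) g g'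
    ⟨Matrix.GeneralLinearGroup.map (w.1.adicCompletionIntegers E).subtype P, (mem_range_map_adicCompletionIntegers_iff_mem_glInt N w.1 _).1 ⟨P, rfl⟩, ?_⟩
  change Matrix.GeneralLinearGroup.map (w.1.adicCompletionIntegers E).subtype P * localSplitEquiv c J hc hJh w hw hJw g *
      (Matrix.GeneralLinearGroup.map (w.1.adicCompletionIntegers E).subtype P)⁻¹ = localSplitEquiv c J hc hJh w hw hJw g'
  rw [he, ← hgw', ← map_inv, ← map_mul, ← map_mul]
  exact congrArg (Matrix.GeneralLinearGroup.map (w.1.adicCompletionIntegers E).subtype) (Units.ext hP)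

end Split

/-! ## §2 The non-split unramified place: unitary integral conjugacy in `U(σ_w, J_w)(E_w)` -/

section Nonsplit

variable {F E : Type} [Field F] [NumberField F] [Field E] [NumberField E] [Algebra F E]
  (c : E ≃ₐ[F] E) (N : ℕ) (J : Matrix (Fin N) (Fin N) E)

variable [Algebra.IsQuadraticExtension F E] {v : HeightOneSpectrum (𝓞 F)}

/-- **Kottwitz's Prop. 7.1 in the one-place unitary group `U(σ_w, J_w)(E_w)` at a SPLIT SEMISIMPLE element, `K = U ∩ GL_N(𝒪_w)`.**  `w ∣ v` non-split,
`v` UNRAMIFIED in `E`, `J` `c`-hermitian with `J_w ∈ GL_N(𝒪_w)`, `γ_w ∈ U ∩ GL_N(𝒪_w)` killed by `(X − a_w)(X − b_w)`, `a_w − b_w ∈ 𝒪_wˣ`, `a_w σ(a_w) = b_w σ(b_w) = 1`: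
every `g_w ∈ U ∩ GL_N(𝒪_w)` which is `GL_N(E_w)`-conjugate to `γ_w` is conjugate to it by an element of `U ∩ GL_N(𝒪_w)` — the `GL_N(𝒪_w)` conjugator is ★
`exists_isUnit_det_mul_eq_mul_of_units_conj_map_eq`, its unitary upgrade ★ `exists_integral_unitary_conj_of_mul_sub_eq_zero` with (trace) ★
`exists_add_map_eq_one_of_isUnit_sub'` and (norm) ★ `exists_mul_map_eq_of_finite_residueField` over the complete DVR `𝒪_w` (finite residue field; `σ_w` moves a
unit: ★ `exists_isUnit_map_sub_of_isUnramifiedIn`). [cite: Kottwitz1986, Prop. 7.1; §7.3] [cite: Rogawski1990, §3.3 p. 21; §3.8 p. 27] -/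
theorem integralConj_unitaryGroupOfForm_of_mul_sub_eq_zero (hc : c ≠ 1) (hJh : (J.map c)ᵀ = J) (w : PlacesOver E v) (hw : c • w.1 = w.1)
    (hv : Algebra.IsUnramifiedIn (𝓞 E) v.asIdeal) (hJw : IsUnit (placeForm J w.1)) (hJi : hJw.unit ∈ glInt N (w.1.adicCompletion E))
    (γw : unitaryGroupOfForm (galAdicCompletionMap (L := E) c hw) (placeForm J w.1))
    (hγint : (γw : GL (Fin N) (w.1.adicCompletion E)) ∈ glInt N (w.1.adicCompletion E))
    (aw bw : w.1.adicCompletionIntegers E) (habw : IsUnit (aw - bw))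
    (haw : (aw : w.1.adicCompletion E) * galAdicCompletionMap (L := E) c hw aw = 1)
    (hbw : (bw : w.1.adicCompletion E) * galAdicCompletionMap (L := E) c hw bw = 1)
    (hγab : ((((γw : GL (Fin N) (w.1.adicCompletion E)) : Matrix (Fin N) (Fin N) (w.1.adicCompletion E))) - (aw : w.1.adicCompletion E) • 1) *
      ((((γw : GL (Fin N) (w.1.adicCompletion E)) : Matrix (Fin N) (Fin N) (w.1.adicCompletion E))) - (bw : w.1.adicCompletion E) • 1) = 0)
    (gw : unitaryGroupOfForm (galAdicCompletionMap (L := E) c hw) (placeForm J w.1))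
    (hgint : (gw : GL (Fin N) (w.1.adicCompletion E)) ∈ glInt N (w.1.adicCompletion E))
    (hconj : IsConj (gw : GL (Fin N) (w.1.adicCompletion E)) (γw : GL (Fin N) (w.1.adicCompletion E))) :
    ∃ k ∈ (glInt N (w.1.adicCompletion E)).subgroupOf (unitaryGroupOfForm (galAdicCompletionMap (L := E) c hw) (placeForm J w.1)),
      k * γw * k⁻¹ = gw := by
  have hfinj : Function.Injective (w.1.adicCompletionIntegers E).subtype := Subtype.val_injective
  -- the instances on `𝒪_w`
  haveI : Finite (IsLocalRing.ResidueField (w.1.adicCompletionIntegers E)) := finite_residueField_adicCompletion E w.1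
  -- the integral involution, (trace) and (norm)
  let σO : w.1.adicCompletionIntegers E →+* w.1.adicCompletionIntegers E :=
    (galAdicCompletionMap (L := E) c hw).restrict (w.1.adicCompletionIntegers E) (w.1.adicCompletionIntegers E)
      fun x hx => (galAdicCompletionMap_mem_adicCompletionIntegers_iff E c hw x).2 hx
  have hσO : ∀ x : w.1.adicCompletionIntegers E, ((σO x : w.1.adicCompletionIntegers E) : w.1.adicCompletion E) =
      galAdicCompletionMap (L := E) c hw x := fun _ => rfl
  have hfσ : ∀ x : w.1.adicCompletionIntegers E, (w.1.adicCompletionIntegers E).subtype (σO x) =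
      galAdicCompletionMap (L := E) c hw ((w.1.adicCompletionIntegers E).subtype x) := fun _ => rfl
  have hσσ : ∀ x, σO (σO x) = x := fun x => Subtype.ext (galAdicCompletionMap_galAdicCompletionMap_of_smul_eq c w hc hw x)
  have hcomp : (⇑(w.1.adicCompletionIntegers E).subtype ∘ ⇑σO) =
      ⇑(galAdicCompletionMap (L := E) c hw) ∘ ⇑(w.1.adicCompletionIntegers E).subtype := funext fun x => hσO x
  obtain ⟨a, ha⟩ := exists_isUnit_map_sub_of_isUnramifiedIn c w hc hw hv σO hσO
  have htr : ∃ t : w.1.adicCompletionIntegers E, t + σO t = 1 :=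
    Literature.NumberTheory.LocalFields.UnramifiedQuadraticNorm.exists_add_map_eq_one_of_isUnit_sub' σO hσσ ha
  have hnorm : ∀ u : w.1.adicCompletionIntegers E, IsUnit u → σO u = u → ∃ t : w.1.adicCompletionIntegers E, t * σO t = u :=
    fun u hu hσu => Literature.NumberTheory.LocalFields.UnramifiedQuadraticNorm.exists_mul_map_eq_of_finite_residueField σO hσσ ha u hu hσu
  -- the integral lift `J̃` of `J_w`
  obtain ⟨Ju, hJu⟩ := (mem_range_map_adicCompletionIntegers_iff_mem_glInt N w.1 _).2 hJi
  have hJtf : (Ju : Matrix (Fin N) (Fin N) (w.1.adicCompletionIntegers E)).map (w.1.adicCompletionIntegers E).subtype = placeForm J w.1 := by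
    have h := congrArg (fun g : GL (Fin N) (w.1.adicCompletion E) => (g : Matrix (Fin N) (Fin N) (w.1.adicCompletion E))) hJu
    rw [IsUnit.unit_spec] at h
    exact h
  have hJt : ((Ju : Matrix (Fin N) (Fin N) (w.1.adicCompletionIntegers E)).map σO)ᵀ = Ju := by
    apply Matrix.map_injective hfinj
    change (((Units.val Ju).map σO)ᵀ).map _ = (Units.val Ju).map _
    rw [Matrix.transpose_map, Matrix.map_map, hcomp, ← Matrix.map_map, hJtf]
    exact placeForm_hermitian_of_smul_eq c w J hJh hw
  have hJtdet : IsUnit (Ju : Matrix (Fin N) (Fin N) (w.1.adicCompletionIntegers E)).det :=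
    (Matrix.isUnit_iff_isUnit_det _).1 Ju.isUnit
  -- the integral lifts `γ̃`, `g̃`: unitary
  obtain ⟨γu, hγu⟩ := (mem_range_map_adicCompletionIntegers_iff_mem_glInt N w.1 _).2 hγint
  obtain ⟨gu, hgu⟩ := (mem_range_map_adicCompletionIntegers_iff_mem_glInt N w.1 _).2 hgint
  have hγtf : (γu : Matrix (Fin N) (Fin N) (w.1.adicCompletionIntegers E)).map (w.1.adicCompletionIntegers E).subtype =
      ((γw : GL (Fin N) (w.1.adicCompletion E)) : Matrix (Fin N) (Fin N) (w.1.adicCompletion E)) :=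
    congrArg (fun g : GL (Fin N) (w.1.adicCompletion E) => (g : Matrix (Fin N) (Fin N) (w.1.adicCompletion E))) hγu
  have hgtf : (gu : Matrix (Fin N) (Fin N) (w.1.adicCompletionIntegers E)).map (w.1.adicCompletionIntegers E).subtype =
      ((gw : GL (Fin N) (w.1.adicCompletion E)) : Matrix (Fin N) (Fin N) (w.1.adicCompletion E)) :=
    congrArg (fun g : GL (Fin N) (w.1.adicCompletion E) => (g : Matrix (Fin N) (Fin N) (w.1.adicCompletion E))) hgu
  have hγtU : ((γu : Matrix (Fin N) (Fin N) (w.1.adicCompletionIntegers E)).map σO)ᵀ * Ju * γu = Ju := by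
    apply Literature.LinearAlgebra.Matrix.formUnitary_of_formUnitary_map (w.1.adicCompletionIntegers E).subtype hfinj hfσ
    rw [hγtf, hJtf]
    exact γw.2
  have hgtU : ((gu : Matrix (Fin N) (Fin N) (w.1.adicCompletionIntegers E)).map σO)ᵀ * Ju * gu = Ju := by
    apply Literature.LinearAlgebra.Matrix.formUnitary_of_formUnitary_map (w.1.adicCompletionIntegers E).subtype hfinj hfσ
    rw [hgtf, hJtf]
    exact gw.2
  -- the scalars: `a σ(a) = b σ(b) = 1` in `𝒪_w`
  have haw' : aw * σO aw = 1 := Subtype.ext haw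
  have hbw' : bw * σO bw = 1 := Subtype.ext hbw
  -- the quadratic relations of the lifts: `γ̃` by injectivity, `g̃` by conjugation
  have hγuab : ((γu : Matrix (Fin N) (Fin N) (w.1.adicCompletionIntegers E)) - aw • 1) *
      ((γu : Matrix (Fin N) (Fin N) (w.1.adicCompletionIntegers E)) - bw • 1) = 0 := by
    refine mul_sub_eq_zero_of_map N (w.1.adicCompletionIntegers E).subtype hfinj ?_
    rw [hγtf]
    exact hγab
  obtain ⟨C, hC⟩ := isConj_iff.1 hconj.symm
  have hPconj : (C : Matrix (Fin N) (Fin N) (w.1.adicCompletion E)) *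
      (γu : Matrix (Fin N) (Fin N) (w.1.adicCompletionIntegers E)).map (w.1.adicCompletionIntegers E).subtype *
        ((C⁻¹ : GL (Fin N) (w.1.adicCompletion E)) : Matrix (Fin N) (Fin N) (w.1.adicCompletion E)) =
      (gu : Matrix (Fin N) (Fin N) (w.1.adicCompletionIntegers E)).map (w.1.adicCompletionIntegers E).subtype := by
    rw [hγtf, hgtf, ← Units.val_mul, ← Units.val_mul, hC]
  have hguab : ((gu : Matrix (Fin N) (Fin N) (w.1.adicCompletionIntegers E)) - aw • 1) *
      ((gu : Matrix (Fin N) (Fin N) (w.1.adicCompletionIntegers E)) - bw • 1) = 0 := by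
    refine mul_sub_eq_zero_of_map N (w.1.adicCompletionIntegers E).subtype hfinj ?_
    rw [← hPconj]
    exact mul_sub_eq_zero_of_units_conj N _ (map_mul_sub_eq_zero N (w.1.adicCompletionIntegers E).subtype hγuab)
  -- ★ FILE 1: the `GL_N(𝒪_w)` conjugator; ★ FILE 2: its unitary upgrade
  obtain ⟨k₀, hk₀, h₀⟩ := Literature.LinearAlgebra.Matrix.exists_isUnit_det_mul_eq_mul_of_units_conj_map_eq (w.1.adicCompletionIntegers E).subtype
    hfinj habw hγuab hguab C hPconj
  obtain ⟨k, hk, hkU, hkconj, -⟩ := Literature.LinearAlgebra.Matrix.exists_integral_unitary_conj_of_mul_sub_eq_zero σO hσσ htr hnorm hJt hJtdet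
    habw haw' hbw' hγuab hγtU hgtU hk₀ h₀
  -- package `k ⊗ 1 ∈ U ∩ GL_N(𝒪_w)` (verbatim as ★ `integralConj_unitaryGroupOfForm`)
  have hkf : IsUnit (k.map (w.1.adicCompletionIntegers E).subtype) :=
    (Matrix.isUnit_iff_isUnit_det _).2 (by rw [← RingHom.mapMatrix_apply, ← RingHom.map_det]; exact hk.map _)
  have hkmem : hkf.unit ∈ unitaryGroupOfForm (galAdicCompletionMap (L := E) c hw) (placeForm J w.1) := by
    rw [mem_unitaryGroupOfForm_iff, IsUnit.unit_spec, ← hJtf]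
    exact Literature.LinearAlgebra.Matrix.formUnitary_map_of_formUnitary (w.1.adicCompletionIntegers E).subtype hfσ hkU
  refine ⟨⟨hkf.unit, hkmem⟩, ?_, ?_⟩
  · rw [Subgroup.mem_subgroupOf]
    change hkf.unit ∈ glInt N (w.1.adicCompletion E)
    refine (mem_range_map_adicCompletionIntegers_iff_mem_glInt N w.1 _).1 ⟨((Matrix.isUnit_iff_isUnit_det k).2 hk).unit, Units.ext ?_⟩
    rw [IsUnit.unit_spec]
    change ((((Matrix.isUnit_iff_isUnit_det k).2 hk).unit : Matrix (Fin N) (Fin N) (w.1.adicCompletionIntegers E))).map _ = _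
    rw [IsUnit.unit_spec]
  · -- `(k ⊗ 1) γ_w (k ⊗ 1)⁻¹ = g_w`: from `g̃ k = k γ̃`
    refine Subtype.ext (Units.ext ?_)
    change (((⟨hkf.unit, hkmem⟩ * γw : unitaryGroupOfForm (galAdicCompletionMap (L := E) c hw) (placeForm J w.1)) :
        GL (Fin N) (w.1.adicCompletion E)) : Matrix (Fin N) (Fin N) (w.1.adicCompletion E)) *
        (((⟨hkf.unit, hkmem⟩ : unitaryGroupOfForm (galAdicCompletionMap (L := E) c hw) (placeForm J w.1))⁻¹ :
          unitaryGroupOfForm (galAdicCompletionMap (L := E) c hw) (placeForm J w.1)) : GL (Fin N) (w.1.adicCompletion E)) = _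
    rw [Subgroup.coe_mul, Subgroup.coe_inv, Units.val_mul, Matrix.coe_units_inv]
    change k.map (w.1.adicCompletionIntegers E).subtype * ((γw : GL (Fin N) (w.1.adicCompletion E)) : Matrix (Fin N) (Fin N) (w.1.adicCompletion E)) *
        (k.map (w.1.adicCompletionIntegers E).subtype)⁻¹ = ((gw : GL (Fin N) (w.1.adicCompletion E)) : Matrix (Fin N) (Fin N) (w.1.adicCompletion E))
    have hkfdet : IsUnit (k.map (w.1.adicCompletionIntegers E).subtype).det := (Matrix.isUnit_iff_isUnit_det _).1 hkf
    have hconjf : (gu : Matrix (Fin N) (Fin N) (w.1.adicCompletionIntegers E)).map (w.1.adicCompletionIntegers E).subtype *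
        k.map (w.1.adicCompletionIntegers E).subtype =
        k.map (w.1.adicCompletionIntegers E).subtype * (γu : Matrix (Fin N) (Fin N) (w.1.adicCompletionIntegers E)).map (w.1.adicCompletionIntegers E).subtype := by
      rw [← Matrix.map_mul, ← Matrix.map_mul, hkconj]
    rw [← hγtf, ← hgtf, ← hconjf, Matrix.mul_nonsing_inv_cancel_right _ _ hkfdet]

/-- **Integral conjugacy at a NON-SPLIT unramified place for a semisimple element with two rational eigenvalues**, in `U(J)(F_v)`: `g = γ ⊗ 1` with
`(γ − a)(γ − b) = 0`, `a c(a) = b c(b) = 1`, `a, b` `w`-integral, `a − b` a `w`-unit, `γ_w ∈ GL_N(𝒪_w)`, `J_w ∈ GL_N(𝒪_w)`, `v` unramified: every `g′ ∈ U(J)(𝒪_v)`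
which is `GL_N(E ⊗ F_v)`-conjugate to `g` is `U(J)(𝒪_v)`-conjugate to it (`integralConj_unitaryGroupOfForm_of_mul_sub_eq_zero` along ★ `localNonsplitEquiv`).
[cite: Kottwitz1986, Prop. 7.1; §7.3] [cite: Rogawski1990, §3.3 p. 21; §3.8 p. 27] -/
theorem integralConj_of_nonsplit_of_mul_sub_eq_zero (hc : c ≠ 1) (hJh : (J.map c)ᵀ = J) (w : PlacesOver E v) (hw : c • w.1 = w.1)
    (hv : Algebra.IsUnramifiedIn (𝓞 E) v.asIdeal) (hJw : IsUnit (placeForm J w.1)) (hJi : hJw.unit ∈ glInt N (w.1.adicCompletion E))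
    (γ : GL (Fin N) E) {a b : E} (hγab : ((γ : Matrix (Fin N) (Fin N) E) - a • 1) * ((γ : Matrix (Fin N) (Fin N) E) - b • 1) = 0)
    (ha : a * c a = 1) (hb : b * c b = 1)
    (aw bw : w.1.adicCompletionIntegers E) (haw : (aw : w.1.adicCompletion E) = algebraMap E (w.1.adicCompletion E) a)
    (hbw : (bw : w.1.adicCompletion E) = algebraMap E (w.1.adicCompletion E) b) (habw : IsUnit (aw - bw))
    (g : «local» E c N J v) (hg : (g : GL (Fin N) (LocalRing E v)) = toLocalGL E v γ)
    (hγw : Matrix.GeneralLinearGroup.map (algebraMap E (w.1.adicCompletion E)) γ ∈ glInt N (w.1.adicCompletion E))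
    (g' : «local» E c N J v) (hg' : g' ∈ localIntegralLevel c N J v)
    (hconj : IsConj (g' : GL (Fin N) (LocalRing E v)) (g : GL (Fin N) (LocalRing E v))) :
    ∃ k ∈ localIntegralLevel c N J v, k * g * k⁻¹ = g' := by
  have he : ((localNonsplitEquiv c J hc w hw g : unitaryGroupOfForm (galAdicCompletionMap (L := E) c hw) (placeForm J w.1)) :
      GL (Fin N) (w.1.adicCompletion E)) = Matrix.GeneralLinearGroup.map (algebraMap E (w.1.adicCompletion E)) γ :=
    localNonsplitEquiv_eq_map_of_eq_toLocalGL c N J hc w hw γ g hg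
  set ev : LocalRing E v →+* w.1.adicCompletion E := Pi.evalRingHom (fun w' : PlacesOver E v => w'.1.adicCompletion E) w with hev
  have hmapev : ∀ u : «local» E c N J v,
      ((localNonsplitEquiv c J hc w hw u : unitaryGroupOfForm (galAdicCompletionMap (L := E) c hw) (placeForm J w.1)) :
        GL (Fin N) (w.1.adicCompletion E)) = Matrix.GeneralLinearGroup.map ev (u : GL (Fin N) (LocalRing E v)) := fun u => Units.ext rfl
  -- the norm-one scalars read in `E_w`
  have hgal : ∀ x : E, galAdicCompletionMap (L := E) c hw (algebraMap E (w.1.adicCompletion E) x) = algebraMap E (w.1.adicCompletion E) (c x) :=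
    fun x => galAdicCompletionMap_coe_algEquiv F c hw x
  have haw1 : (aw : w.1.adicCompletion E) * galAdicCompletionMap (L := E) c hw aw = 1 := by
    rw [haw, hgal, ← map_mul, ha, map_one]
  have hbw1 : (bw : w.1.adicCompletion E) * galAdicCompletionMap (L := E) c hw bw = 1 := by
    rw [hbw, hgal, ← map_mul, hb, map_one]
  refine integralConj_of_mulEquiv (localNonsplitEquiv c J hc w hw).toMulEquiv (localIntegralLevel c N J v)
    ((glInt N (w.1.adicCompletion E)).subgroupOf (unitaryGroupOfForm (galAdicCompletionMap (L := E) c hw) (placeForm J w.1)))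
    (fun u => by rw [Subgroup.mem_subgroupOf]; exact mem_localIntegralLevel_iff_of_smul_eq c N J hc w hw u) g g' ?_
  refine integralConj_unitaryGroupOfForm_of_mul_sub_eq_zero c N J hc hJh w hw hv hJw hJi (localNonsplitEquiv c J hc w hw g)
    (by rw [he]; exact hγw) aw bw habw haw1 hbw1 (by rw [he, haw, hbw]; exact map_mul_sub_eq_zero N (algebraMap E (w.1.adicCompletion E)) hγab)
    (localNonsplitEquiv c J hc w hw g') ((mem_localIntegralLevel_iff_of_smul_eq c N J hc w hw g').1 hg') ?_
  -- conjugacy in `GL_N(E_w)`: the `w`-component of `hconj`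
  rw [hmapev, hmapev]
  exact (Matrix.GeneralLinearGroup.map ev).map_isConj hconj

end Nonsplit

/-! ## §3 Almost every place: split ∨ non-split -/

section AE

variable {F E : Type} [Field F] [NumberField F] [Field E] [NumberField E] [Algebra F E]
  (c : E ≃ₐ[F] E) (N : ℕ) (J : Matrix (Fin N) (Fin N) E)

/-- Only finitely many places of `F` ramify in `E` (private copy of ★ `GaloisRepresentations.finite_setOf_not_isUnramifiedIn`, outside this import cone). [folklore] -/
private theorem finite_setOf_ramified :
    {v : HeightOneSpectrum (𝓞 F) | ¬ Algebra.IsUnramifiedIn (𝓞 E) v.asIdeal}.Finite := by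
  have hD : differentIdeal (𝓞 F) (𝓞 E) ≠ ⊥ := differentIdeal_ne_bot
  have hfin : {Q : HeightOneSpectrum (𝓞 E) | Q.asIdeal ∣ differentIdeal (𝓞 F) (𝓞 E)}.Finite :=
    Ideal.finite_factors hD
  refine (hfin.image fun Q => Q.under (𝓞 F)).subset ?_
  intro q hq
  simp only [Set.mem_setOf_eq, Algebra.IsUnramifiedIn, not_forall] at hq
  obtain ⟨Q, hQprime, hQover, hQunr⟩ := hq
  haveI := hQprime
  have hQne : Q ≠ ⊥ := Ideal.ne_bot_of_liesOver_of_ne_bot q.ne_bot Q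
  refine ⟨⟨Q, hQprime, hQne⟩, ?_, ?_⟩
  · exact dvd_differentIdeal_iff.mpr hQunr
  · exact HeightOneSpectrum.ext hQover.over.symm

omit [NumberField F] [Algebra F E] in
/-- **`a, b` are `w`-integral and `a − b` is a `w`-unit at almost every place** (`a ≠ b`): integral representatives `a_w, b_w ∈ 𝒪_w` with `a_w − b_w ∈ 𝒪_wˣ`
(★ `eventually_mem_adicCompletionIntegers`, ★ `eventually_valued_algebraMap_eq_one`). [folklore] -/
private theorem eventually_exists_integers_isUnit_sub {a b : E} (hab : a ≠ b) :
    ∀ᶠ w : HeightOneSpectrum (𝓞 E) in cofinite, ∃ aw bw : w.adicCompletionIntegers E,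
      (aw : w.adicCompletion E) = algebraMap E (w.adicCompletion E) a ∧ (bw : w.adicCompletion E) = algebraMap E (w.adicCompletion E) b ∧
        IsUnit (aw - bw) := by
  filter_upwards [eventually_mem_adicCompletionIntegers (E := E) a, eventually_mem_adicCompletionIntegers (E := E) b,
    eventually_valued_algebraMap_eq_one (E := E) (sub_ne_zero.2 hab)] with w ha hb hv
  have hint : (Valued.v (R := w.adicCompletion E)).Integers (w.adicCompletionIntegers E) := Valuation.integer.integers _
  refine ⟨⟨_, ha⟩, ⟨_, hb⟩, rfl, rfl, hint.isUnit_iff_valuation_eq_one.mpr ?_⟩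
  change Valued.v (algebraMap E (w.adicCompletion E) a - algebraMap E (w.adicCompletion E) b) = 1
  rw [← map_sub, hv]

variable [Algebra.IsQuadraticExtension F E]

/-- **Kottwitz's Prop. 7.1 in the `K_v`-conjugacy form at a SEMISIMPLE element with two rational eigenvalues, at almost every place of `F`.**  For `c ≠ 1`,
`J` `c`-hermitian with `det J` a unit, `γ ∈ GL_N(E)` with `(γ − a)(γ − b) = 0`, `a ≠ b`, `a c(a) = b c(b) = 1` (the singular non-central semisimple elements of
`U(3)`: eigenvalues `{a, a, b}`) and `γ ⊗ 1 ∈ U(J)(F_v)` for every `v` (the `g v`): for all but finitely many `v` — off the ramified places, those with `J_w` or `γ_w`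
not in `GL_N(𝒪_w)`, `a` or `b` not integral, `a − b` not a unit — EVERY `g′ ∈ U(J)(𝒪_v)` `GL_N(E ⊗ F_v)`-CONJUGATE to `γ ⊗ 1` is conjugate to it by an element of
`U(J)(𝒪_v)` (split places §1, inert places §2). [cite: Kottwitz1986, Prop. 7.1; §7.3] [cite: Rogawski1990, §3.3 p. 21; §3.8 p. 27] -/
theorem eventually_forall_integralConj_of_mul_sub_eq_zero (hc : c ≠ 1) (hJh : (J.map c)ᵀ = J) (hJ : IsUnit J.det) (γ : GL (Fin N) E)
    {a b : E} (hab : a ≠ b) (hγab : ((γ : Matrix (Fin N) (Fin N) E) - a • 1) * ((γ : Matrix (Fin N) (Fin N) E) - b • 1) = 0)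
    (ha : a * c a = 1) (hb : b * c b = 1) (g : ∀ v : HeightOneSpectrum (𝓞 F), «local» E c N J v)
    (hg : ∀ v, (g v : GL (Fin N) (LocalRing E v)) = toLocalGL E v γ) :
    ∀ᶠ v : HeightOneSpectrum (𝓞 F) in cofinite, ∀ g' : «local» E c N J v, g' ∈ localIntegralLevel c N J v →
      IsConj (g' : GL (Fin N) (LocalRing E v)) (g v : GL (Fin N) (LocalRing E v)) →
        ∃ k ∈ localIntegralLevel c N J v, k * g v * k⁻¹ = g' := by
  have hJu : IsUnit J := (Matrix.isUnit_iff_isUnit_det J).2 hJ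
  filter_upwards [eventually_forall_unit_placeForm_mem_glInt (F := F) N J hJu, eventually_forall_map_mem_glInt F E γ,
    eventually_forall_placesOver E (eventually_exists_integers_isUnit_sub (E := E) hab),
    (finite_setOf_ramified (F := F) (E := E)).compl_mem_cofinite] with v hint hγint hsc hunr g' hg' hconj
  have hv : Algebra.IsUnramifiedIn (𝓞 E) v.asIdeal := not_not.1 hunr
  obtain ⟨w⟩ := (inferInstance : Nonempty (PlacesOver E v))
  obtain ⟨aw, bw, haw, hbw, habw⟩ := hsc w
  by_cases hw : c • w.1 = w.1
  · exact integralConj_of_nonsplit_of_mul_sub_eq_zero c N J hc hJh w hw hv (isUnit_placeForm J hJu w.1) (hint w) γ hγab ha hb aw bw haw hbw habw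
      (g v) (hg v) (hγint w) g' hg' hconj
  · exact integralConj_of_split_of_mul_sub_eq_zero c N J hc hJh w hw (isUnit_placeForm J hJu w.1) (hint w) γ hγab aw bw haw hbw habw
      (g v) (hg v) (hγint w) g' hg' hconj

end AE

end Literature.NumberTheory.Automorphic.UnitaryGroup

end
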